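import Summits.CriticalPhenomena.PercolationContinuityZ3.Theorems.PercNearOneGluingNoHeavyQuantHoeffdingExtremal
import Summits.CriticalPhenomena.PercolationContinuityZ3.Theorems.PercNearOneGluingNoHeavyQuantThreeValuedReduction
import Summits.CriticalPhenomena.PercolationContinuityZ3.Theorems.PercNearOneGluingNoHeavyQuantBinomialBlobsHeavy
import Literature.Computability.FineGrained.MonotoneOVProofs
import HarnessLib

/-!
# QUANT lane R8, T-DEC: THE BOUNDARY INEQUALITY OF CONJECTURE C — for every Poisson-binomial law with gate sum `2` on `n` trials,
# `(n+2)·P(0) + n·P(1) ≤ n − 2` (equivalently `n·P(X ≥ 2) ≥ 2 + 2·P(X = 0)`), by Hoeffding's extremal principle (prim-quant-census-2 gen 83, file 13)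

builds on p205010 (kernel theorem, internal audit signed; external expert review pending)

Support file (`--supports stmt-CriticalPhenomena-4575`), QUANT lane census seat prim-quant-census-2 (gen 83); memo
`run/shared/lean/prim/quant/prim-quant-census-2-g83/HOEFFDING-G83.md` §3.  Theorems only, standard axioms, no sorries, no definitions.

REFLECTION-G82.md §3 ("the boundary form"): the uniform-spreading load of conjecture C (census-2 g82; `L ≤ 1` for every Poisson-binomial law
would give conjecture BLOB-AFL at every width by one flow pattern) is numerically maximal as the gate sum `s ↓ 2`, where it tends to
`2P₀/(2P₀+P₁) + 2P₁/((n−2)(1−P₀−P₁))`, and `L(2⁺) ≤ 1 ⟺ (n+2)·P₀ + n·P₁ ≤ n − 2` for laws of gate sum `2`.  This file proves that inequality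
for EVERY gate vector and EVERY width — the first all-width piece of conjecture C beyond `s ≤ 2` — as the first application of the extremal
principle `exists_threeValued_ge` (`…QuantHoeffdingExtremal`): the functional is linear in the law, so it suffices to treat the three-valued
vectors `(1^m, g^r, 0^z)` with `m + r·g = 2`: `m ≥ 2` (no mass at `0, 1`), `m = 1` (`P₁ = (1 − 1/r)^r ≤ 1/2`, the tree's `one_sub_inv_pow_le_half`), `m = 0` (the binomial `Bin(r, 2/r)`:
`(1 − 2/r)^{r−1} ≤ r²/(5r² − 8r + 4)` by the second-order Bernoulli bound, then a cubic in `r ≥ 8`; `3 ≤ r ≤ 7` numerically).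
* `one_add_pow_ge_two_terms` (second-order Bernoulli), `pow_one_sub_two_div_le`; `(1 − 1/r)^r ≤ 1/2` is REUSED from
  `Literature.Computability.FineGrained.MonotoneOV.one_sub_inv_pow_le_half` (already in the tree).
* **`pb_boundary_ineq_sum_two`** — `G ⊂ [0,1]`, `ΣG = 2`: `(|G|+2)·P_G(0) + |G|·P_G(1) ≤ |G| − 2` (`P_G = blobLaw (G.map (1,·))`).

HONEST STATUS.  One inequality; conjecture C itself (all `s > 2`), BLOB-AFL beyond the assembled widths, `SiblingStep`, `FarTreeRow`, `GluedLemmaW`,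
`GluedDominatedMass` OPEN; RATE class (log\*) / honest sentence of `run/shared/lean/prim/quant/README.md` unchanged.  [this work].  Nothing here is
cited as a published result ([cite: Hoeffding1956, Theorem 5] is the classical source of the three-value phenomenon, proved in `…QuantHoeffdingMixture`).
The gluing rows served [cite: KozmaNitzan2024, Conjecture 3 (p. 15)]; product measure [cite: Grimmett1999, §1.3 p. 10].
-/

noncomputable section

open scoped BigOperators

namespace Summit.CriticalPhenomena.PercolationContinuityZ3.Theorems
namespace Quant

open Finset

/-- the blob list of a gate list at the common blob size `k` -/
local notation3 "BL[" k ", " G "]" => LawDec.blobLaw (List.map (fun g : ℝ => ((k : ℕ), g)) G)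

namespace LawDec

/-! ### Elementary power bounds -/

/-- second-order Bernoulli: `(1 + x)^n ≥ 1 + n x + n(n−1)/2 · x²` for `x ≥ 0`. [folklore] -/
theorem one_add_pow_ge_two_terms (x : ℝ) (hx : 0 ≤ x) :
    ∀ n : ℕ, 1 + (n : ℝ) * x + ((n : ℝ) * ((n : ℝ) - 1) / 2) * x ^ 2 ≤ (1 + x) ^ n
  | 0 => by simp
  | n + 1 => by
    have ih := one_add_pow_ge_two_terms x hx n
    have hn0 : (0 : ℝ) ≤ (n : ℝ) * ((n : ℝ) - 1) := by
      rcases Nat.eq_zero_or_pos n with h | h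
      · subst h; simp
      · have : (1 : ℝ) ≤ n := by exact_mod_cast h
        nlinarith
    rw [pow_succ]
    push_cast
    calc 1 + ((n : ℝ) + 1) * x + ((n : ℝ) + 1) * ((n : ℝ) + 1 - 1) / 2 * x ^ 2
        ≤ (1 + (n : ℝ) * x + (n : ℝ) * ((n : ℝ) - 1) / 2 * x ^ 2) * (1 + x) := by
          nlinarith [mul_nonneg hn0 (pow_nonneg hx 3)]
      _ ≤ (1 + x) ^ n * (1 + x) := mul_le_mul_of_nonneg_right ih (by linarith)

/-- `(1 − 2/r)^{r−1} ≤ r²/(5r² − 8r + 4)` for `r ≥ 2` (second-order Bernoulli on `(1 + 2/r)^{r−1}` and `(1 − 4/r²)^{r−1} ≤ 1`). [folklore] -/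
theorem pow_one_sub_two_div_le (r : ℕ) (hr : 2 ≤ r) :
    (1 - 2 / (r : ℝ)) ^ (r - 1) ≤ (r : ℝ) ^ 2 / (5 * (r : ℝ) ^ 2 - 8 * r + 4) := by
  have hr' : (2 : ℝ) ≤ r := by exact_mod_cast hr
  have hr0 : (0 : ℝ) < r := by linarith
  have hD : 0 < 5 * (r : ℝ) ^ 2 - 8 * r + 4 := by nlinarith
  have hcast : ((r - 1 : ℕ) : ℝ) = (r : ℝ) - 1 := by
    rw [Nat.cast_sub (by omega : 1 ≤ r)]; simp
  -- `(1 + 2/r)^{r-1} ≥ 5 − 8/r + 4/r² = (5r² − 8r + 4)/r²`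
  have h1 : (5 * (r : ℝ) ^ 2 - 8 * r + 4) / (r : ℝ) ^ 2 ≤ (1 + 2 / (r : ℝ)) ^ (r - 1) := by
    have := one_add_pow_ge_two_terms (2 / (r : ℝ)) (by positivity) (r - 1)
    rw [hcast] at this
    have e : 1 + ((r : ℝ) - 1) * (2 / r) + ((r : ℝ) - 1) * ((r : ℝ) - 1 - 1) / 2 * (2 / r) ^ 2
        = (5 * (r : ℝ) ^ 2 - 8 * r + 4) / (r : ℝ) ^ 2 := by
      field_simp; ring
    rw [e] at this
    exact this
  have ha0 : 0 ≤ 1 - 2 / (r : ℝ) := by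
    rw [sub_nonneg, div_le_one hr0]; exact hr'
  have h2 : (1 - 2 / (r : ℝ)) ^ (r - 1) * (1 + 2 / (r : ℝ)) ^ (r - 1) ≤ 1 := by
    rw [← mul_pow]
    apply pow_le_one₀ (mul_nonneg ha0 (by positivity))
    have : (1 - 2 / (r : ℝ)) * (1 + 2 / r) = 1 - (2 / r) ^ 2 := by ring
    rw [this]
    linarith [sq_nonneg (2 / (r : ℝ))]
  have hb0 : 0 < (5 * (r : ℝ) ^ 2 - 8 * r + 4) / (r : ℝ) ^ 2 := by positivity
  -- `a ≤ 1/b ≤ r²/(5r²−8r+4)`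
  rw [le_div_iff₀ hD]
  have hab : (1 - 2 / (r : ℝ)) ^ (r - 1) * ((5 * (r : ℝ) ^ 2 - 8 * r + 4) / (r : ℝ) ^ 2) ≤ 1 := by
    calc (1 - 2 / (r : ℝ)) ^ (r - 1) * ((5 * (r : ℝ) ^ 2 - 8 * r + 4) / (r : ℝ) ^ 2)
        ≤ (1 - 2 / (r : ℝ)) ^ (r - 1) * (1 + 2 / (r : ℝ)) ^ (r - 1) :=
          mul_le_mul_of_nonneg_left h1 (pow_nonneg ha0 _)
      _ ≤ 1 := h2
  have e : (1 - 2 / (r : ℝ)) ^ (r - 1) * (5 * (r : ℝ) ^ 2 - 8 * r + 4)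
      = ((1 - 2 / (r : ℝ)) ^ (r - 1) * ((5 * (r : ℝ) ^ 2 - 8 * r + 4) / (r : ℝ) ^ 2)) * (r : ℝ) ^ 2 := by
    field_simp
  rw [e]
  calc ((1 - 2 / (r : ℝ)) ^ (r - 1) * ((5 * (r : ℝ) ^ 2 - 8 * r + 4) / (r : ℝ) ^ 2)) * (r : ℝ) ^ 2
      ≤ 1 * (r : ℝ) ^ 2 := mul_le_mul_of_nonneg_right hab (by positivity)
    _ = (r : ℝ) ^ 2 := one_mul _

/-! ### The three-valued cases -/

/-- case `m = 1`: one sure success and `r ≥ 2` gates `1/r`, `n ≥ r + 1` trials: `n·(1 − 1/r)^r ≤ n − 2`. [this work] -/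
theorem boundary_case_one (r : ℕ) (hr : 2 ≤ r) (n : ℝ) (hn : (r : ℝ) + 1 ≤ n) :
    n * (1 - 1 / (r : ℝ)) ^ r ≤ n - 2 := by
  have hr' : (2 : ℝ) ≤ r := by exact_mod_cast hr
  rcases Nat.lt_or_ge r 3 with h3 | h3
  · have : r = 2 := by omega
    subst this
    norm_num at hn ⊢
    nlinarith
  · have h := Literature.Computability.FineGrained.MonotoneOV.one_sub_inv_pow_le_half r (by omega)
    have hr3 : (3 : ℝ) ≤ r := by exact_mod_cast h3
    have hn0 : 0 ≤ n := by linarith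
    nlinarith [mul_le_mul_of_nonneg_left h hn0]

/-- case `m = 0`: the binomial `Bin(r, 2/r)`, `r ≥ 3`, `n ≥ r` trials: `(n+2)(1 − 2/r)^r + 2n(1 − 2/r)^{r−1} ≤ n − 2`. [this work] -/
theorem boundary_case_zero (r : ℕ) (hr : 3 ≤ r) (n : ℝ) (hn : (r : ℝ) ≤ n) :
    (n + 2) * (1 - 2 / (r : ℝ)) ^ r + 2 * n * (1 - 2 / (r : ℝ)) ^ (r - 1) ≤ n - 2 := by
  have hr' : (3 : ℝ) ≤ r := by exact_mod_cast hr
  have hr0 : (0 : ℝ) < r := by linarith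
  have hq0 : 0 ≤ 1 - 2 / (r : ℝ) := by rw [sub_nonneg, div_le_one hr0]; linarith
  -- `q^r = q · q^{r-1}`
  have epow : (1 - 2 / (r : ℝ)) ^ r = (1 - 2 / (r : ℝ)) * (1 - 2 / (r : ℝ)) ^ (r - 1) := by
    rw [← pow_succ']; congr 1; omega
  rw [epow]
  set u := (1 - 2 / (r : ℝ)) ^ (r - 1) with hu
  have hu0 : 0 ≤ u := pow_nonneg hq0 _
  rcases Nat.lt_or_ge r 8 with h8 | h8
  · -- `3 ≤ r ≤ 7`: exact values of `u`
    interval_cases r <;> norm_num [hu] at hn ⊢ <;> nlinarith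
  · -- `r ≥ 8`: `u ≤ r²/(5r²−8r+4)` and a cubic
    have hr8 : (8 : ℝ) ≤ r := by exact_mod_cast h8
    have hD : 0 < 5 * (r : ℝ) ^ 2 - 8 * r + 4 := by nlinarith
    have hU := pow_one_sub_two_div_le r (by omega)
    rw [← hu] at hU
    -- `u · (5r² − 8r + 4) ≤ r²`
    have hU' : u * (5 * (r : ℝ) ^ 2 - 8 * r + 4) ≤ (r : ℝ) ^ 2 := (le_div_iff₀ hD).1 hU
    -- the coefficient of `u` is nonnegative
    have hc : 0 ≤ (n + 2) * (1 - 2 / (r : ℝ)) + 2 * n := by nlinarith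
    -- target: `u · ((n+2)(1−2/r) + 2n) ≤ n − 2`; multiply by `r(5r²−8r+4) > 0`
    have key : ((n + 2) * (1 - 2 / (r : ℝ)) + 2 * n) * (r : ℝ) ^ 2
        ≤ (n - 2) * (5 * (r : ℝ) ^ 2 - 8 * r + 4) := by
      have e : ((n + 2) * (1 - 2 / (r : ℝ)) + 2 * n) * (r : ℝ) ^ 2 = r * (3 * n * r - 2 * n + 2 * r - 4) := by
        field_simp; ring
      rw [e]
      -- `(n−2)(5r²−8r+4) − r(3nr − 2n + 2r − 4) = 2(r−1)(n(r−2) − 2(3r−2)) ≥ 0` for `n ≥ r ≥ 8`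
      nlinarith [mul_nonneg (by linarith : (0 : ℝ) ≤ (r : ℝ) - 1) (by nlinarith : (0 : ℝ) ≤ n * ((r : ℝ) - 2) - 2 * (3 * r - 2))]
    calc (n + 2) * ((1 - 2 / (r : ℝ)) * u) + 2 * n * u = u * ((n + 2) * (1 - 2 / (r : ℝ)) + 2 * n) := by ring
      _ ≤ n - 2 := by
          rw [← sub_nonneg]
          have h1 : 0 ≤ ((r : ℝ) ^ 2 - u * (5 * (r : ℝ) ^ 2 - 8 * r + 4)) * ((n + 2) * (1 - 2 / (r : ℝ)) + 2 * n) :=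
            mul_nonneg (by linarith) hc
          have h2 : 0 ≤ (n - 2) * (5 * (r : ℝ) ^ 2 - 8 * r + 4) - ((n + 2) * (1 - 2 / (r : ℝ)) + 2 * n) * (r : ℝ) ^ 2 := by
            linarith
          -- `(n − 2 − u·c)·(5r²−8r+4) = h2-part + h1-part ≥ 0`
          have h3 : 0 ≤ (n - 2 - u * ((n + 2) * (1 - 2 / (r : ℝ)) + 2 * n)) * (5 * (r : ℝ) ^ 2 - 8 * r + 4) := by
            nlinarith
          have h4 : (0 : ℝ) * (5 * (r : ℝ) ^ 2 - 8 * r + 4)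
              ≤ (n - 2 - u * ((n + 2) * (1 - 2 / (r : ℝ)) + 2 * n)) * (5 * (r : ℝ) ^ 2 - 8 * r + 4) := by linarith
          exact le_of_mul_le_mul_right h4 hD

/-! ### The boundary inequality -/

/-- **THE BOUNDARY INEQUALITY OF CONJECTURE C.**  For every gate list `G ⊂ [0,1]` with `ΣG = 2` (`n = |G|` trials, `P_G` the law of the number of
successes): `(n+2)·P_G(0) + n·P_G(1) ≤ n − 2`, i.e. `n·P(X ≥ 2) ≥ 2·(1 + P(X = 0))`. [this work] -/
theorem pb_boundary_ineq_sum_two (G : List ℝ) (hG : ∀ g ∈ G, 0 ≤ g ∧ g ≤ 1) (hS : G.sum = 2) :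
    ((G.length : ℝ) + 2) * BL[1, G] 0 + (G.length : ℝ) * BL[1, G] 1 ≤ (G.length : ℝ) - 2 := by
  classical
  set n := G.length with hn
  obtain ⟨F, hlen, hsum, hF01, ⟨g, hg0, hg1, hval⟩, hle⟩ :=
    exists_threeValued_ge G hG 1 2 (fun h => if h = 0 then (n : ℝ) + 2 else n)
  have e2 : ∀ L : List ℝ, ∑ h ∈ Finset.range 2, (if h = 0 then (n : ℝ) + 2 else n) * BL[1, L] h
      = ((n : ℝ) + 2) * BL[1, L] 0 + (n : ℝ) * BL[1, L] 1 := by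
    intro L
    simp only [Finset.sum_range_succ, Finset.sum_range_zero, zero_add]
    simp
  rw [e2, e2] at hle
  refine hle.trans ?_
  -- normal form of the three-valued list
  obtain ⟨m, r, z, hmrz, hperm⟩ := perm_replicate_of_threeValued g F hval
  have hlawF : BL[1, F] = BL[1, List.replicate m 1 ++ List.replicate r g] := by
    rw [blobLaw_perm (hperm.map (fun x : ℝ => (1, x)))]
    exact blobLaw_append_zeros_eq 1 z _
  have hFsum : F.sum = m + r * g := by
    rw [hperm.sum_eq]; simp only [List.sum_append, List.sum_replicate, nsmul_eq_mul, mul_one, mul_zero, add_zero]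
  have hmr : (m : ℝ) + r * g = 2 := by rw [← hFsum, hsum, hS]
  have hnmr : (m : ℝ) + r ≤ n := by
    have : m + r ≤ n := by rw [hn, ← hlen, ← hmrz]; omega
    exact_mod_cast this
  have hr0 : (0 : ℝ) ≤ r := Nat.cast_nonneg r
  have hP : ∀ h, BL[1, F] h = if m * 1 ≤ h then blobLaw (List.replicate r (1, g)) (h - m * 1) else 0 := by
    intro h; rw [hlawF]; exact blobLaw_onesEqual_eq 1 m r g h
  rcases Nat.lt_or_ge m 2 with hm2 | hm2
  · interval_cases m
    · -- `m = 0`: the binomial `Bin(r, g)` with `r g = 2`, so `r ≥ 3`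
      simp only [Nat.cast_zero, zero_add] at hmr hnmr
      have hr3 : 3 ≤ r := by
        by_contra h
        have : (r : ℝ) ≤ 2 := by exact_mod_cast (by omega : r ≤ 2)
        nlinarith
      have hr3' : (3 : ℝ) ≤ r := by exact_mod_cast hr3
      have hrpos : (0 : ℝ) < r := by linarith
      have hg : g = 2 / r := by field_simp; linarith
      have hP0 : BL[1, F] 0 = (1 - g) ^ r := by
        rw [hP 0, if_pos (by omega), show 0 - 0 * 1 = 0 * 1 by simp, blobLaw_replicate 1 one_pos g r 0]
        simp
      have hP1 : BL[1, F] 1 = r * g * (1 - g) ^ (r - 1) := by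
        rw [hP 1, if_pos (by omega), show 1 - 0 * 1 = 1 * 1 by simp, blobLaw_replicate 1 one_pos g r 1]
        simp
      rw [hP0, hP1, show (r : ℝ) * g = 2 by linarith, hg]
      have := boundary_case_zero r hr3 n hnmr
      linarith
    · -- `m = 1`: `r g = 1`, `r ≥ 2`
      simp only [Nat.cast_one] at hmr hnmr
      have hr2 : 2 ≤ r := by
        by_contra h
        have : (r : ℝ) ≤ 1 := by exact_mod_cast (by omega : r ≤ 1)
        nlinarith
      have hr2' : (2 : ℝ) ≤ r := by exact_mod_cast hr2
      have hrpos : (0 : ℝ) < r := by linarith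
      have hg : g = 1 / r := by field_simp; linarith
      have hP0 : BL[1, F] 0 = 0 := by rw [hP 0, if_neg (by omega)]
      have hP1 : BL[1, F] 1 = (1 - g) ^ r := by
        rw [hP 1, if_pos (by omega), show 1 - 1 * 1 = 0 * 1 by simp, blobLaw_replicate 1 one_pos g r 0]
        simp
      rw [hP0, hP1, mul_zero, zero_add, hg]
      exact boundary_case_one r hr2 n (by linarith)
  · -- `m ≥ 2`: no mass at `0` or `1`
    have hP0 : BL[1, F] 0 = 0 := by rw [hP 0, if_neg (by omega)]
    have hP1 : BL[1, F] 1 = 0 := by rw [hP 1, if_neg (by omega)]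
    rw [hP0, hP1, mul_zero, mul_zero, add_zero]
    have : (2 : ℝ) ≤ m := by exact_mod_cast hm2
    linarith

end LawDec
end Quant
end Summit.CriticalPhenomena.PercolationContinuityZ3.Theorems
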